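import Mathlib

/-!
# Eigen-climb: uniqueness of eigen-elements in a filtered group (engine 1's `W(f)` toy model, target T108 — an instrument,
# NOT a resolution theorem)

The abstract CLIMB LEMMA of RE-DERIVATION-eng1-g44 §3.2 (L8) / CARVER-NOTES-eng1-g44 §2 (T108): the *uniqueness* twin of the
eigen-coset lift (`EigenCosetLift.lift`, existence).  Setting: a group `G`, subgroups `N' ≤ N` with `[G, N] ⊆ N'`, `N / N'` of exponent
`p`, an endomorphism `s` of `G` acting on `N / N'` as the scalar `λ` (`s n ≡ n ^ λ`).  If `Φ` is an exact eigen-element (`s Φ = Φ ^ n₀`),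
`x` an eigen-element up to an error in `N'` (`s x = x ^ n₀ * h`, `h ∈ N'`), and `x ≡ Φ (mod N)` (`Φ⁻¹ x ∈ N`), then at a
NON-RESONANT level (`p ∤ λ - n₀`) the congruence improves: `Φ⁻¹ x ∈ N'` (`climb_step`).  Along a descending filtration
`F a ⊇ F (a+1) ⊇ ⋯ ⊇ F t` with `[G, F m] ⊆ F (m+1)`, `F m / F (m+1)` of exponent `p`, `s ≡ λ m` on `F m / F (m+1)` and every level
`a ≤ m < t` non-resonant, `Φ⁻¹ x ∈ F a` climbs to `Φ⁻¹ x ∈ F t` (`climb`); if `F t = ⊥` then `x = Φ` (`climb_exact`).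

Proof of the step (ten lines of group theory): `E := Φ⁻¹ x ∈ N` is central modulo `N'`, so `s E = (s Φ)⁻¹ s x = Φ ^ (-n₀) (Φ E) ^ n₀ h
≡ E ^ n₀ (mod N')`, while `s E ≡ E ^ λ`; hence `E ^ (λ - n₀) ∈ N'`, and with `E ^ p ∈ N'`, `p ∤ λ - n₀` this forces `E ∈ N'`.

Toy-model dictionary (CARVER-NOTES-eng1-g44 §2, three instances; all bookkeeping happens there, not here): `G = 𝔄_1`
(graded automorphisms `≡ id mod σ`), `F m = 𝔄_m`, `s = s_{μ₀}` (`σ ↦ μ₀ σ`), `λ m = μ₀ ^ m`, `n₀ ≡ μ₀ ^ r`;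
(i) THEOREM A⁺, `2 ≤ r ≤ p - 1`: `Φ = Φ_𝔇(σ^r)`, `x` = the eigen-lifted `X'`, `t = p + 1` (`r = 2`) or `p + 2` (`r ≥ 3`) ⇒
`X' = Φ ∘ E`, `E ∈ 𝔄_{p+1}`; (ii) THEOREM B, `2 ≤ r ≤ p - 1`: `t = p + 1`; (iii) THEOREM B, `r = 1`: the truncated group `𝔄̄_1`
over `k[σ]/(σ^p)`, `F p = ⊥`, `Φ = Ψ_𝔇(σ̄)`, `t = p` ⇒ `red X' = Ψ_𝔇(σ̄)` (`climb_exact`).  Non-resonance there is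
`μ₀ ^ m ≠ μ₀ ^ r` for `0 < m - r ≤ p - 2` (`μ₀` a generator of `𝔽_pˣ`).
No hypothesis `(P)` and no polynomial algebra enters: this file is the group-theoretic skeleton only (Mathlib-only, same conventions as
`EigenCosetLift`: integer exponents `la`, `n₀`, the scalar action as `s n * (n ^ la)⁻¹ ∈ N'`).
-/

namespace Literature.AlgebraicGeometry.Resolution.WeightedBlowup.EigenClimb

variable {G : Type*} [Group G]

/-- The arithmetic core: an element killed by a prime `p` and by an integer `d` with `p ∤ d` is trivial (its order divides
`gcd (p, d) = 1`). [cite: Lang2002, Ch. I §§3, 6] -/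
theorem eq_one_of_pow_prime_eq_one_of_zpow_eq_one (p : ℕ) [hp : Fact p.Prime] {g : G} (hgp : g ^ p = 1) {d : ℤ}
    (hgd : g ^ d = 1) (hd : ¬ (p : ℤ) ∣ d) : g = 1 := by
  rcases (Nat.dvd_prime hp.out).mp (orderOf_dvd_of_pow_eq_one hgp) with h1 | h1
  · exact orderOf_eq_one_iff.mp h1
  · exact absurd (h1 ▸ orderOf_dvd_iff_zpow_eq_one.mpr hgd) hd

/-- **CLIMB, one level** (RE-DERIVATION-eng1-g44 §3.2 (L8); CARVER-NOTES-eng1-g44 §2 T108; instrument for engine 1's `W(f)` toy model, NOT a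
resolution theorem).  `N' ≤ N ≤ G`, `[G, N] ⊆ N'`, `N / N'` of exponent `p`, `s` acts on `N / N'` as the scalar `la`, and the level is
NON-RESONANT: `p ∤ la - n₀`.  If `s Φ = Φ ^ n₀` exactly, `s x = x ^ n₀ * h` with `h ∈ N'`, and `Φ⁻¹ * x ∈ N`, then
`Φ⁻¹ * x ∈ N'` (`E := Φ⁻¹ x` is central mod `N'`, so `E ^ la ≡ s E = Φ ^ (-n₀) (Φ E) ^ n₀ h ≡ E ^ n₀`; `E ^ (la - n₀), E ^ p ∈ N'`
and `p ∤ la - n₀` give `E ∈ N'`). [cite: Lang2002, Ch. I §§3, 6; AbramovichTemkinWlodarczyk2024, §5.1 (p. 1575)] -/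
theorem climb_step (s : G →* G) {N N' : Subgroup G} (hN'N : N' ≤ N) (hcomm : ∀ g : G, ∀ n ∈ N, g * n * g⁻¹ * n⁻¹ ∈ N')
    (p : ℕ) [Fact p.Prime] (hexp : ∀ n ∈ N, n ^ p ∈ N') (la n₀ : ℤ) (hs : ∀ n ∈ N, s n * (n ^ la)⁻¹ ∈ N')
    (hla : ¬ (p : ℤ) ∣ la - n₀) {Φ x h : G} (hE : Φ⁻¹ * x ∈ N) (hh : h ∈ N') (hΦ : s Φ = Φ ^ n₀) (hx : s x = x ^ n₀ * h) :
    Φ⁻¹ * x ∈ N' := by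
  haveI : N'.Normal := ⟨fun n hn g => by
    have h1 := N'.mul_mem (hcomm g n (hN'N hn)) hn
    rwa [inv_mul_cancel_right] at h1⟩
  obtain ⟨E, rfl⟩ : ∃ E, x = Φ * E := ⟨Φ⁻¹ * x, (mul_inv_cancel_left Φ x).symm⟩
  rw [inv_mul_cancel_left] at hE ⊢
  rw [← QuotientGroup.eq_one_iff]
  -- `E ^ p ≡ 1`
  have hp1 : (E : G ⧸ N') ^ p = 1 := by
    rw [← QuotientGroup.mk_pow, QuotientGroup.eq_one_iff]
    exact hexp E hE
  -- `s E ≡ E ^ la`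
  have hsla : ((s E : G) : G ⧸ N') = (E : G ⧸ N') ^ la := by
    have h1 : ((s E * (E ^ la)⁻¹ : G) : G ⧸ N') = 1 := (QuotientGroup.eq_one_iff _).mpr (hs E hE)
    rwa [QuotientGroup.mk_mul, QuotientGroup.mk_inv, mul_inv_eq_one, QuotientGroup.mk_zpow] at h1
  -- `E` is central modulo `N'`
  have hc : Commute (Φ : G ⧸ N') (E : G ⧸ N') := by
    have h1 : ((Φ * E * Φ⁻¹ * E⁻¹ : G) : G ⧸ N') = 1 := (QuotientGroup.eq_one_iff _).mpr (hcomm Φ E hE)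
    rw [QuotientGroup.mk_mul, QuotientGroup.mk_mul, QuotientGroup.mk_mul, QuotientGroup.mk_inv, QuotientGroup.mk_inv,
      mul_inv_eq_one, mul_inv_eq_iff_eq_mul] at h1
    exact h1
  -- `s E = (s Φ)⁻¹ s (Φ E) ≡ E ^ n₀`
  have hsn : ((s E : G) : G ⧸ N') = (E : G ⧸ N') ^ n₀ := by
    have h1 : s E = (Φ ^ n₀)⁻¹ * ((Φ * E) ^ n₀ * h) := by
      rw [← hx, ← hΦ, ← map_inv, ← map_mul, inv_mul_cancel_left]
    rw [h1]
    simp only [QuotientGroup.mk_mul, QuotientGroup.mk_inv, QuotientGroup.mk_zpow]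
    rw [(QuotientGroup.eq_one_iff h).mpr hh, mul_one, hc.mul_zpow, inv_mul_cancel_left]
  have hd : (E : G ⧸ N') ^ (la - n₀) = 1 := by
    rw [zpow_sub, mul_inv_eq_one, ← hsla, hsn]
  exact eq_one_of_pow_prime_eq_one_of_zpow_eq_one p hp1 hd hla

/-- **CLIMB along a filtration** (RE-DERIVATION-eng1-g44 §3.2 (L8); CARVER-NOTES-eng1-g44 §2 T108; instrument, NOT a resolution theorem).
`F` a descending chain of subgroups with `[G, F m] ⊆ F (m+1)`, `F m / F (m+1)` of exponent `p` on which `s` acts as the scalar `la m`;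
if every level `a ≤ m < t` is non-resonant (`p ∤ la m - n₀`), `s Φ = Φ ^ n₀`, `s x = x ^ n₀ * h` with `h ∈ F t`, and
`Φ⁻¹ * x ∈ F a`, then `Φ⁻¹ * x ∈ F t`: an approximate eigen-element congruent to an exact one at level `a` is congruent to it
up to the first resonant level or the level of its error term. [cite: Lang2002, Ch. I §§3, 6; AbramovichTemkinWlodarczyk2024, §5.1 (p. 1575)] -/
theorem climb (s : G →* G) (p : ℕ) [Fact p.Prime] (n₀ : ℤ) (F : ℕ → Subgroup G) (hF : Antitone F)
    (hcomm : ∀ m, ∀ g : G, ∀ n ∈ F m, g * n * g⁻¹ * n⁻¹ ∈ F (m + 1)) (hexp : ∀ m, ∀ n ∈ F m, n ^ p ∈ F (m + 1))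
    (la : ℕ → ℤ) (hs : ∀ m, ∀ n ∈ F m, s n * (n ^ la m)⁻¹ ∈ F (m + 1)) {a t : ℕ} (hat : a ≤ t)
    (hla : ∀ m, a ≤ m → m < t → ¬ (p : ℤ) ∣ la m - n₀) {Φ x h : G} (hE : Φ⁻¹ * x ∈ F a) (hh : h ∈ F t)
    (hΦ : s Φ = Φ ^ n₀) (hx : s x = x ^ n₀ * h) : Φ⁻¹ * x ∈ F t := by
  suffices key : ∀ m, a ≤ m → m ≤ t → Φ⁻¹ * x ∈ F m from key t hat le_rfl
  intro m ham
  induction m, ham using Nat.le_induction with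
  | base => exact fun _ => hE
  | succ m ham ih =>
    exact fun hmt => climb_step s (hF m.le_succ) (hcomm m) p (hexp m) (la m) n₀ (hs m) (hla m ham (Nat.lt_of_succ_le hmt))
      (ih (Nat.le_of_succ_le hmt)) (hF hmt hh) hΦ hx

/-- The terminal case (`F t = ⊥`, e.g. `𝔄̄_p = {id}` in the truncated group, or `h = 1` and `𝔄_{p+2} = {id}`): the approximate
eigen-element IS the exact one, `x = Φ` — in the toy model, "`X' = Φ_𝔇(σ^r)`" / "`red X' = Ψ_𝔇(σ̄)`"
(CARVER-NOTES-eng1-g44 §2 (ii)/(iii)). [cite: Lang2002, Ch. I §§3, 6; AbramovichTemkinWlodarczyk2024, §5.1 (p. 1575)] -/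
theorem climb_exact (s : G →* G) (p : ℕ) [Fact p.Prime] (n₀ : ℤ) (F : ℕ → Subgroup G) (hF : Antitone F)
    (hcomm : ∀ m, ∀ g : G, ∀ n ∈ F m, g * n * g⁻¹ * n⁻¹ ∈ F (m + 1)) (hexp : ∀ m, ∀ n ∈ F m, n ^ p ∈ F (m + 1))
    (la : ℕ → ℤ) (hs : ∀ m, ∀ n ∈ F m, s n * (n ^ la m)⁻¹ ∈ F (m + 1)) {a t : ℕ} (hat : a ≤ t) (ht : F t = ⊥)
    (hla : ∀ m, a ≤ m → m < t → ¬ (p : ℤ) ∣ la m - n₀) {Φ x h : G} (hE : Φ⁻¹ * x ∈ F a) (hh : h ∈ F t)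
    (hΦ : s Φ = Φ ^ n₀) (hx : s x = x ^ n₀ * h) : x = Φ := by
  have h1 := climb s p n₀ F hF hcomm hexp la hs hat hla hE hh hΦ hx
  rw [ht, Subgroup.mem_bot, inv_mul_eq_one] at h1
  exact h1.symm

/-- **Uniqueness of exact eigen-elements**: two exact eigen-elements (`s Φ = Φ ^ n₀`, `s x = x ^ n₀`) congruent at level `a` are
congruent up to the first resonant level `t` (the case `h = 1` of `climb`).
[cite: Lang2002, Ch. I §§3, 6; AbramovichTemkinWlodarczyk2024, §5.1 (p. 1575)] -/
theorem climb_of_exact (s : G →* G) (p : ℕ) [Fact p.Prime] (n₀ : ℤ) (F : ℕ → Subgroup G) (hF : Antitone F)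
    (hcomm : ∀ m, ∀ g : G, ∀ n ∈ F m, g * n * g⁻¹ * n⁻¹ ∈ F (m + 1)) (hexp : ∀ m, ∀ n ∈ F m, n ^ p ∈ F (m + 1))
    (la : ℕ → ℤ) (hs : ∀ m, ∀ n ∈ F m, s n * (n ^ la m)⁻¹ ∈ F (m + 1)) {a t : ℕ} (hat : a ≤ t)
    (hla : ∀ m, a ≤ m → m < t → ¬ (p : ℤ) ∣ la m - n₀) {Φ x : G} (hE : Φ⁻¹ * x ∈ F a)
    (hΦ : s Φ = Φ ^ n₀) (hx : s x = x ^ n₀) : Φ⁻¹ * x ∈ F t :=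
  climb s p n₀ F hF hcomm hexp la hs hat hla hE (one_mem _) hΦ (by rw [hx, mul_one])

end Literature.AlgebraicGeometry.Resolution.WeightedBlowup.EigenClimb
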